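import Literature.Analysis.PDE.FlatApproxSolve
import Literature.Analysis.PDE.PatchResidualIdentity
import Literature.Analysis.PDE.FrameOpSmooth
import HarnessLib

/-!
# The frame operator: locality, local additivity, and its commutator with a cut-off
# (topic `Analysis/PDE`)

Analytic layer of the programme to prove short-time existence for quasilinear strictly
parabolic systems on a closed manifold (hypothesis `hQL` of
`Literature.Geometry.Riemannian.ricciFlow_shortTime_existence_of_quasilinear`). When approximate
solutions constructed chart by chart are glued with cut-offs, the only cross-chart error is the
**commutator** of the operator `L u = frameOp S 𝔟 𝔠 u` with the cut-off,

  `commOp S 𝔟 𝔠 cut u y = L (cut • u) y - cut y • L u y = lowerSymbol S cut u y + 𝔟 (dcut(y) ⊗ u(y))`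

(`commOp_eq`), a FIRST-order expression in `u` supported on the support of `cut`; in the weighted
energies it therefore carries the gain `λ^{-1/2}`. This file proves:

* `frameOp_congr_of_eventuallyEq` — locality: `frameOp S 𝔟 𝔠 u y` depends only on the germ of
  `u` at `y`; `frameOp_zero_fun`; `frameOp_sum_of_contDiffOn` — additivity for summands that are
  smooth only on an open neighbourhood (bump-function reduction to `FlatStep.frameOp_sum`);
* `commOp`, `commOp_eq`, `commOp_eq_zero` (off `tsupport cut`), slab-smoothness of the frame
  operator and of the commutator (`isSmoothSpaceTimeOn_frameOp`, `isSmoothSpaceTimeOn_commOp`);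
* `sobolevEnergy_commOp_le` — for every order `k` and bound `M` there is `C < ∞` with
  `E_k(commOp) ≤ C (Σ_a E_k(∂_a u) + E_k(u))` whenever the iterated derivatives of the symbol field
  and of the first-order coefficient field up to order `k`, and of the cut-off up to order `k + 2`,
  are bounded by `M` (crude Leibniz bounds; no smallness is needed for a first-order term).

Everything is proved; no named fact and no `sorry` is introduced.

## References

* L. C. Evans, *Partial Differential Equations*, 2nd ed., AMS 2010, §6.3.1 (commuting a cut-off
  through a second-order operator), §7.1.3. [Evans2010]
* L. Hörmander, *The Analysis of Linear Partial Differential Operators III*, Springer 1985,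
  §17.1. [Hormander1985III]
-/

noncomputable section

open Set Function Filter Topology Metric MeasureTheory InnerProductSpace
open scoped ContDiff Topology ENNReal RealInnerProductSpace Laplacian

namespace Literature.Analysis.PDE

open Literature.Analysis.FunctionSpaces Literature.Analysis.FluidPDE TopologicalSpace

variable {E' : Type*} [NormedAddCommGroup E'] [InnerProductSpace ℝ E'] [FiniteDimensional ℝ E']
variable {F' : Type*} [NormedAddCommGroup F'] [InnerProductSpace ℝ F']

/-! ### Locality and local additivity of the frame operator -/

/-- A bump equal to `1` near a point of an open set and supported inside it. [folklore] -/
theorem exists_bump_of_isOpen {V : Set E'} (hV : IsOpen V) {y : E'} (hy : y ∈ V) :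
    ∃ ψ : E' → ℝ, ContDiff ℝ ∞ ψ ∧ tsupport ψ ⊆ V ∧ ψ =ᶠ[𝓝 y] fun _ ↦ 1 := by
  obtain ⟨ε, hε, hball⟩ := Metric.isOpen_iff.1 hV y hy
  let b : ContDiffBump y := ⟨ε / 4, ε / 2, by linarith, by linarith⟩
  refine ⟨b, b.contDiff, ?_, b.eventuallyEq_one⟩
  rw [b.tsupport_eq]
  exact (closedBall_subset_ball (by show ε / 2 < ε; linarith)).trans hball

/-- **Local additivity**: for summands smooth on an open `V ∋ y`,
`frameOp (Σ uᵢ) y = Σ frameOp uᵢ y`. [folklore] -/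
theorem frameOp_sum_of_contDiffOn (S₀ : E' →L[ℝ] E') (𝔟₀ : (E' →L[ℝ] F') →L[ℝ] F') (𝔠₀ : F' →L[ℝ] F')
    {ι : Type*} [Fintype ι] {u : ι → E' → F'} {V : Set E'} (hV : IsOpen V) {y : E'} (hy : y ∈ V)
    (hu : ∀ i, ContDiffOn ℝ ∞ (u i) V) :
    frameOp S₀ 𝔟₀ 𝔠₀ (fun z ↦ ∑ i, u i z) y = ∑ i, frameOp S₀ 𝔟₀ 𝔠₀ (u i) y := by
  obtain ⟨ψ, hψ, hψV, hψ1⟩ := exists_bump_of_isOpen hV hy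
  have hsm : ∀ i, ContDiff ℝ ∞ fun z ↦ ψ z • u i z := fun i ↦ contDiff_smul_of_tsupport_subset hV hψ hψV (hu i)
  have hev : ∀ i, (fun z ↦ ψ z • u i z) =ᶠ[𝓝 y] u i := fun i ↦ by
    filter_upwards [hψ1] with z hz
    rw [hz, one_smul]
  have hevs : (fun z ↦ ∑ i, ψ z • u i z) =ᶠ[𝓝 y] fun z ↦ ∑ i, u i z := by
    filter_upwards [hψ1] with z hz
    simp [hz]
  rw [← frameOp_congr_of_eventuallyEq S₀ 𝔟₀ 𝔠₀ hevs, FlatStep.frameOp_sum S₀ 𝔟₀ 𝔠₀ hsm y]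
  exact Finset.sum_congr rfl fun i _ ↦ frameOp_congr_of_eventuallyEq S₀ 𝔟₀ 𝔠₀ (hev i)

/-! ### The commutator with a cut-off -/

/-- **The commutator of the frame operator with a cut-off**:
`commOp S 𝔟 𝔠 cut u y = frameOp S 𝔟 𝔠 (cut • u) y - cut y • frameOp S 𝔟 𝔠 u y`.
[cite: Evans2010, §6.3.1] -/
def commOp (S₀ : E' →L[ℝ] E') (𝔟₀ : (E' →L[ℝ] F') →L[ℝ] F') (𝔠₀ : F' →L[ℝ] F') (cut : E' → ℝ) (u : E' → F')
    (y : E') : F' :=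
  frameOp S₀ 𝔟₀ 𝔠₀ (fun z ↦ cut z • u z) y - cut y • frameOp S₀ 𝔟₀ 𝔠₀ u y

/-- `commOp_apply`: unfolding. [folklore] -/
theorem commOp_apply (S₀ : E' →L[ℝ] E') (𝔟₀ : (E' →L[ℝ] F') →L[ℝ] F') (𝔠₀ : F' →L[ℝ] F') (cut : E' → ℝ) (u : E' → F')
    (y : E') :
    commOp S₀ 𝔟₀ 𝔠₀ cut u y = frameOp S₀ 𝔟₀ 𝔠₀ (fun z ↦ cut z • u z) y - cut y • frameOp S₀ 𝔟₀ 𝔠₀ u y := rfl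

/-- **The commutator is first order in `u`**:
`commOp S 𝔟 𝔠 cut u y = lowerSymbol S cut u y + 𝔟 ((dcut(y)).smulRight (u y))` (the zeroth-order
coefficient commutes with the cut-off, the first-order one produces `𝔟(dcut ⊗ u)`, the principal
part produces the lower symbol terms). [cite: Evans2010, §6.3.1] -/
theorem commOp_eq (S₀ : E' →L[ℝ] E') (𝔟₀ : (E' →L[ℝ] F') →L[ℝ] F') (𝔠₀ : F' →L[ℝ] F') {cut : E' → ℝ}
    (hcut : ContDiff ℝ ∞ cut) {u : E' → F'} (hu : ContDiff ℝ ∞ u) (y : E') :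
    commOp S₀ 𝔟₀ 𝔠₀ cut u y = lowerSymbol S₀ cut u y + 𝔟₀ ((fderiv ℝ cut y).smulRight (u y)) := by
  rw [commOp_apply, frameOp_apply, frameOp_apply]
  have h1 := cut_smul_principalPart_eq isOpen_univ hcut (subset_univ _) hu.contDiffOn S₀ y
  have h2 : fderiv ℝ (fun z ↦ cut z • u z) y = cut y • fderiv ℝ u y + (fderiv ℝ cut y).smulRight (u y) :=
    fderiv_smul (hcut.differentiable (by simp) y) (hu.differentiable (by simp) y)
  rw [h2, map_add, map_smul, map_smul, smul_add, smul_add, h1]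
  abel

/-- **The commutator is supported on the support of the cut-off.** [folklore] -/
theorem commOp_eq_zero (S₀ : E' →L[ℝ] E') (𝔟₀ : (E' →L[ℝ] F') →L[ℝ] F') (𝔠₀ : F' →L[ℝ] F') {cut : E' → ℝ}
    (u : E' → F') {y : E'} (hy : y ∉ tsupport cut) : commOp S₀ 𝔟₀ 𝔠₀ cut u y = 0 := by
  have hev : cut =ᶠ[𝓝 y] fun _ ↦ 0 := notMem_tsupport_iff_eventuallyEq.1 hy
  have hev' : (fun z ↦ cut z • u z) =ᶠ[𝓝 y] fun _ ↦ 0 := by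
    filter_upwards [hev] with z hz; simp [hz]
  rw [commOp_apply, frameOp_eq_zero_of_eventuallyEq_zero S₀ 𝔟₀ 𝔠₀ hev', hev.eq_of_nhds, zero_smul, sub_zero]

/-- `tsupport (commOp … cut u) ⊆ tsupport cut`. [folklore] -/
theorem tsupport_commOp_subset (S₀ : E' → (E' →L[ℝ] E')) (𝔟₀ : E' → ((E' →L[ℝ] F') →L[ℝ] F')) (𝔠₀ : E' → (F' →L[ℝ] F'))
    (cut : E' → ℝ) (u : E' → F') :
    tsupport (fun y ↦ commOp (S₀ y) (𝔟₀ y) (𝔠₀ y) cut u y) ⊆ tsupport cut := by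
  refine closure_minimal (fun y hy ↦ ?_) (isClosed_tsupport _)
  by_contra h
  exact hy (commOp_eq_zero _ _ _ u h)

/-! ### Slab smoothness -/

section Slab

variable {T : ℝ}

/-- **Slab smoothness of the commutator.** [folklore] -/
theorem isSmoothSpaceTimeOn_commOp (hT : 0 < T) {S : ℝ → E' → (E' →L[ℝ] E')}
    {𝔟 : ℝ → E' → ((E' →L[ℝ] F') →L[ℝ] F')} {𝔠 : ℝ → E' → (F' →L[ℝ] F')}
    (hS : IsSmoothSpaceTimeOn (Icc 0 T) S) (h𝔟 : IsSmoothSpaceTimeOn (Icc 0 T) 𝔟) (h𝔠 : IsSmoothSpaceTimeOn (Icc 0 T) 𝔠)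
    {cut : E' → ℝ} (hcut : ContDiff ℝ ∞ cut) {u : ℝ → E' → F'} (hu : IsSmoothSpaceTimeOn (Icc 0 T) u) :
    IsSmoothSpaceTimeOn (Icc 0 T) fun s y ↦ commOp (S s y) (𝔟 s y) (𝔠 s y) cut (u s) y := by
  have hv : IsSmoothSpaceTimeOn (Icc 0 T) fun s z ↦ cut z • u s z := (isSmoothSpaceTimeOn_const_time hcut _).smul hu
  have h1 := isSmoothSpaceTimeOn_frameOp hT hS h𝔟 h𝔠 hv
  have h2 := isSmoothSpaceTimeOn_frameOp hT hS h𝔟 h𝔠 hu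
  have h3 : IsSmoothSpaceTimeOn (Icc 0 T) fun s y ↦ cut y • frameOp (S s y) (𝔟 s y) (𝔠 s y) (u s) y :=
    (isSmoothSpaceTimeOn_const_time hcut _).smul h2
  exact h1.sub h3

end Slab

/-! ### The energy of the commutator -/

section Energy

variable [MeasurableSpace E'] [BorelSpace E']

omit [MeasurableSpace E'] [BorelSpace E'] in
/-- Expansion of `𝔟 (dcut(y) ⊗ w)` in the frame:
`𝔟 ((dcut y).smulRight w) = Σ_l ∂_l cut(y) • 𝔟 (⟪b_l, ·⟫ ⊗ w)`. [folklore] -/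
theorem clm_smulRight_fderiv_eq_sum (𝔟₀ : (E' →L[ℝ] F') →L[ℝ] F') (cut : E' → ℝ) (y : E') (w : F') :
    𝔟₀ ((fderiv ℝ cut y).smulRight w) = ∑ l, fderiv ℝ cut y (stdOrthonormalBasis ℝ E' l) •
      𝔟₀ (ContinuousLinearMap.smulRightL ℝ E' F' (innerSL ℝ (stdOrthonormalBasis ℝ E' l)) w) := by
  have h : (fderiv ℝ cut y).smulRight w = ∑ l, fderiv ℝ cut y (stdOrthonormalBasis ℝ E' l) •
      ContinuousLinearMap.smulRightL ℝ E' F' (innerSL ℝ (stdOrthonormalBasis ℝ E' l)) w := by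
    ext x
    simp only [ContinuousLinearMap.smulRight_apply, FunLike.coe_sum, Finset.sum_apply, FunLike.coe_smul, Pi.smul_apply,
      ContinuousLinearMap.smulRightL_apply_apply, innerSL_apply_apply, smul_smul, ← Finset.sum_smul]
    congr 1
    conv_lhs => rw [← (stdOrthonormalBasis ℝ E').sum_repr' x]
    rw [map_sum]
    refine Finset.sum_congr rfl fun l _ ↦ ?_
    rw [map_smul, smul_eq_mul, mul_comm]
  rw [h, map_sum]
  exact Finset.sum_congr rfl fun l _ ↦ by rw [map_smul]

omit [MeasurableSpace E'] [BorelSpace E'] in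
/-- Sup and frame-word bounds from uniform bounds of the iterated derivatives. [folklore] -/
theorem norm_and_words_le_of_iteratedFDeriv_le {V : Type*} [NormedAddCommGroup V] [NormedSpace ℝ V]
    {φ : E' → V} (hφ : ContDiff ℝ ∞ φ) {k : ℕ} {Mθ : ℝ} (hb : ∀ j ≤ k, ∀ y, ‖iteratedFDeriv ℝ j φ y‖ ≤ Mθ) :
    (∀ y, ‖φ y‖ ≤ Mθ) ∧ ∀ lst : List (Fin (Module.finrank ℝ E')), lst ≠ [] → lst.length ≤ k →
      ∀ y, ‖iterDirDeriv (lst.map (stdOrthonormalBasis ℝ E')) φ y‖ ≤ Mθ := by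
  refine ⟨fun y ↦ ?_, fun lst _ hl y ↦ (norm_iterDirDeriv_frame_le hφ lst y).trans (hb _ hl y)⟩
  have h := hb 0 (Nat.zero_le _) y
  rwa [norm_iteratedFDeriv_zero] at h

set_option maxHeartbeats 800000 in
/-- **The energy of the commutator**: for every order `k` and bound `M` there is `C < ∞` such
that `E_k(commOp S 𝔟 𝔠 cut u) ≤ C (Σ_a E_k(∂_a u) + E_k(u))` whenever the iterated derivatives of the
symbol field `S` and of the first-order field `𝔟` up to order `k` and of `cut` up to order `k + 2`
are bounded by `M` (all smooth; `u` smooth). [cite: Evans2010, §7.1.3] -/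
theorem sobolevEnergy_commOp_le (k : ℕ) (M : ℝ) :
    ∃ C : ℝ≥0∞, C ≠ ⊤ ∧ ∀ {S₀ : E' → (E' →L[ℝ] E')} {𝔟₀ : E' → ((E' →L[ℝ] F') →L[ℝ] F')}
      {𝔠₀ : E' → (F' →L[ℝ] F')} {cut : E' → ℝ} {u : E' → F'},
      ContDiff ℝ ∞ S₀ → ContDiff ℝ ∞ 𝔟₀ → ContDiff ℝ ∞ cut → ContDiff ℝ ∞ u →
      (∀ m ≤ k, ∀ y, ‖iteratedFDeriv ℝ m S₀ y‖ ≤ M) → (∀ m ≤ k, ∀ y, ‖iteratedFDeriv ℝ m 𝔟₀ y‖ ≤ M) →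
      (∀ m ≤ k + 2, ∀ y, ‖iteratedFDeriv ℝ m cut y‖ ≤ M) →
      sobolevEnergy k (fun y ↦ commOp (S₀ y) (𝔟₀ y) (𝔠₀ y) cut u y) ≤
        C * ((∑ a, sobolevEnergy k (fun y ↦ fderiv ℝ u y (stdOrthonormalBasis ℝ E' a))) + sobolevEnergy k u) := by
  obtain ⟨Ccr, hCcrtop, hCcr⟩ := sobolevEnergy_smul_le_crude (E := E') (F := F') k
  obtain ⟨Ccl, hCcltop, hCcl⟩ := sobolevEnergy_clm_apply_le_crude (E := E') (F := F') (G := F') k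
  set n : ℕ := Module.finrank ℝ E' with hn
  set Mθ : ℝ := 2 ^ k * M ^ 2 + |M| + 1 with hMθ
  have hMθ1 : 1 ≤ Mθ := by rw [hMθ]; nlinarith [abs_nonneg M, sq_nonneg M, pow_pos (two_pos (α := ℝ)) k]
  set A : ℝ≥0∞ := Ccr * ENNReal.ofReal (Mθ ^ 2) with hA
  set B : ℝ≥0∞ := Ccl * ENNReal.ofReal (Mθ ^ 2) with hB
  have hAtop : A ≠ ⊤ := ENNReal.mul_ne_top hCcrtop ENNReal.ofReal_ne_top
  have hBtop : B ≠ ⊤ := ENNReal.mul_ne_top hCcltop ENNReal.ofReal_ne_top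
  refine ⟨16 * (n : ℝ≥0∞) ^ 3 * A + 4 * (n : ℝ≥0∞) ^ 4 * A + 2 * (n : ℝ≥0∞) ^ 2 * (A * B), ?_, ?_⟩
  · refine ENNReal.add_ne_top.2 ⟨ENNReal.add_ne_top.2 ⟨?_, ?_⟩, ?_⟩
    · exact ENNReal.mul_ne_top (ENNReal.mul_ne_top (by norm_num) (ENNReal.pow_ne_top (ENNReal.natCast_ne_top n))) hAtop
    · exact ENNReal.mul_ne_top (ENNReal.mul_ne_top (by norm_num) (ENNReal.pow_ne_top (ENNReal.natCast_ne_top n))) hAtop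
    · exact ENNReal.mul_ne_top (ENNReal.mul_ne_top (by norm_num) (ENNReal.pow_ne_top (ENNReal.natCast_ne_top n)))
        (ENNReal.mul_ne_top hAtop hBtop)
  intro S₀ 𝔟₀ 𝔠₀ cut u hS₀ h𝔟₀ hcut hu hMS hM𝔟 hMc
  have hM0 : 0 ≤ M := (norm_nonneg _).trans (hMS 0 (Nat.zero_le _) 0)
  have hMle : M ≤ Mθ := by rw [hMθ]; nlinarith [le_abs_self M, sq_nonneg M, pow_pos (two_pos (α := ℝ)) k]
  have hM2le : (2 : ℝ) ^ k * M * M ≤ Mθ := by rw [hMθ]; nlinarith [abs_nonneg M]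
  -- ## the coefficient functions
  set e : OrthonormalBasis (Fin n) ℝ E' := stdOrthonormalBasis ℝ E' with he
  obtain ⟨m, hm⟩ : ∃ m : Fin n → Fin n → E' → ℝ, m = fun a l y ↦ ⟪e a, S₀ y (e l)⟫ := ⟨_, rfl⟩
  obtain ⟨dcut, hdcut⟩ : ∃ dcut : Fin n → E' → ℝ, dcut = fun a y ↦ fderiv ℝ cut y (e a) := ⟨_, rfl⟩
  obtain ⟨ddcut, hddcut⟩ : ∃ ddcut : Fin n → Fin n → E' → ℝ,
    ddcut = fun a l y ↦ fderiv ℝ (fun z ↦ fderiv ℝ cut z (e l)) y (e a) := ⟨_, rfl⟩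
  obtain ⟨du, hdu⟩ : ∃ du : Fin n → E' → F', du = fun l y ↦ fderiv ℝ u y (e l) := ⟨_, rfl⟩
  obtain ⟨Q, hQ⟩ : ∃ Q : Fin n → (F' →L[ℝ] (E' →L[ℝ] F')),
    Q = fun l ↦ ContinuousLinearMap.smulRightL ℝ E' F' (innerSL ℝ (e l)) := ⟨_, rfl⟩
  obtain ⟨Bf, hBf⟩ : ∃ Bf : Fin n → E' → (F' →L[ℝ] F'), Bf = fun l y ↦ (𝔟₀ y).comp (Q l) := ⟨_, rfl⟩
  -- smoothness
  have hm_s : ∀ a l, ContDiff ℝ ∞ (m a l) := fun a l ↦ by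
    rw [hm]; exact contDiff_const.inner ℝ (hS₀.clm_apply contDiff_const)
  have hdcut_s : ∀ a, ContDiff ℝ ∞ (dcut a) := fun a ↦ by rw [hdcut]; exact contDiff_fderiv_apply_of_contDiff hcut _
  have hddcut_s : ∀ a l, ContDiff ℝ ∞ (ddcut a l) := fun a l ↦ by
    rw [hddcut]; exact contDiff_fderiv_apply_of_contDiff (contDiff_fderiv_apply_of_contDiff hcut _) _
  have hdu_s : ∀ l, ContDiff ℝ ∞ (du l) := fun l ↦ by
    rw [hdu]; exact (hu.fderiv_right (m := ∞) (by norm_cast)).clm_apply contDiff_const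
  have hBf_s : ∀ l, ContDiff ℝ ∞ (Bf l) := fun l ↦ by rw [hBf]; exact h𝔟₀.clm_comp contDiff_const
  -- iterated-derivative bounds
  have hm_b : ∀ a l, ∀ j ≤ k, ∀ y, ‖iteratedFDeriv ℝ j (m a l) y‖ ≤ M := by
    intro a l j hj y
    rw [hm]
    refine (norm_iteratedFDeriv_inner_apply_le hS₀ (e a) (e l) j y).trans ?_
    rw [(stdOrthonormalBasis ℝ E').orthonormal.1 a, (stdOrthonormalBasis ℝ E').orthonormal.1 l, one_mul, one_mul]
    exact hMS j hj y
  have hfd_b : ∀ {f : E' → ℝ}, ContDiff ℝ ∞ f → ∀ (v : E') (j : ℕ) (y : E'),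
      ‖iteratedFDeriv ℝ j (fun y ↦ fderiv ℝ f y v) y‖ ≤ ‖v‖ * ‖iteratedFDeriv ℝ (j + 1) f y‖ := by
    intro f hf v j y
    have h := norm_iteratedFDeriv_clm_apply_const ((hf.fderiv_right (m := ∞) (by norm_cast)).contDiffAt) (c := v)
      (x := y) (n := j) (by exact_mod_cast le_top)
    rw [norm_iteratedFDeriv_fderiv] at h
    exact h
  have hdcut_b : ∀ a, ∀ j ≤ k + 1, ∀ y, ‖iteratedFDeriv ℝ j (dcut a) y‖ ≤ M := by
    intro a j hj y
    rw [hdcut]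
    refine (hfd_b hcut (e a) j y).trans ?_
    rw [(stdOrthonormalBasis ℝ E').orthonormal.1 a, one_mul]
    exact hMc (j + 1) (by omega) y
  have hddcut_b : ∀ a l, ∀ j ≤ k, ∀ y, ‖iteratedFDeriv ℝ j (ddcut a l) y‖ ≤ M := by
    intro a l j hj y
    have h1 : ddcut a l = fun y ↦ fderiv ℝ (dcut l) y (e a) := by rw [hddcut, hdcut]
    rw [h1]
    refine (hfd_b (hdcut_s l) (e a) j y).trans ?_
    rw [(stdOrthonormalBasis ℝ E').orthonormal.1 a, one_mul]
    exact hdcut_b l (j + 1) (by omega) y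
  have hQn : ∀ l, ‖Q l‖ ≤ 1 := fun l ↦ by rw [hQ]; exact FlatStep.norm_smulRightL_innerSL_le l
  have hBf_b : ∀ l, ∀ j ≤ k, ∀ y, ‖iteratedFDeriv ℝ j (Bf l) y‖ ≤ M := by
    intro l j hj y
    rw [hBf]
    refine (norm_iteratedFDeriv_precomp_le h𝔟₀ (Q l) j y).trans ?_
    calc ‖Q l‖ * ‖iteratedFDeriv ℝ j 𝔟₀ y‖ ≤ 1 * M := mul_le_mul (hQn l) (hM𝔟 j hj y) (norm_nonneg _) zero_le_one
      _ = M := one_mul M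
  -- products
  have hprod : ∀ {φ ψ : E' → ℝ}, ContDiff ℝ ∞ φ → ContDiff ℝ ∞ ψ → (∀ j ≤ k, ∀ y, ‖iteratedFDeriv ℝ j φ y‖ ≤ M) →
      (∀ j ≤ k, ∀ y, ‖iteratedFDeriv ℝ j ψ y‖ ≤ M) → ∀ j ≤ k, ∀ y, ‖iteratedFDeriv ℝ j (fun y ↦ φ y * ψ y) y‖ ≤ Mθ := by
    intro φ ψ hφ hψ hφb hψb j hj y
    have h := norm_iteratedFDeriv_smul_le_of_bounds (F := ℝ) hφ hψ j y hM0 (fun i hi ↦ hφb i (hi.trans hj) y)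
      (fun i hi ↦ hψb i (hi.trans hj) y)
    refine h.trans ?_
    calc (2 : ℝ) ^ j * M * M ≤ 2 ^ k * M * M := by gcongr; norm_num
      _ ≤ Mθ := hM2le
  -- word and sup bounds from iterated-derivative bounds
  have hθ1 : ∀ a l, (∀ y, |m a l y * dcut a y| ≤ Mθ) ∧ ∀ lst : List (Fin n), lst ≠ [] → lst.length ≤ k →
      ∀ y, ‖iterDirDeriv (lst.map e) (fun y ↦ m a l y * dcut a y) y‖ ≤ Mθ := by
    intro a l
    obtain ⟨h0, hw⟩ := norm_and_words_le_of_iteratedFDeriv_le ((hm_s a l).mul (hdcut_s a)) (hprod (hm_s a l) (hdcut_s a) (hm_b a l)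
      (fun j hj y ↦ hdcut_b a j (by omega) y))
    exact ⟨fun y ↦ by rw [← Real.norm_eq_abs]; exact h0 y, hw⟩
  have hθ2 : ∀ a l, (∀ y, |m a l y * dcut l y| ≤ Mθ) ∧ ∀ lst : List (Fin n), lst ≠ [] → lst.length ≤ k →
      ∀ y, ‖iterDirDeriv (lst.map e) (fun y ↦ m a l y * dcut l y) y‖ ≤ Mθ := by
    intro a l
    obtain ⟨h0, hw⟩ := norm_and_words_le_of_iteratedFDeriv_le ((hm_s a l).mul (hdcut_s l)) (hprod (hm_s a l) (hdcut_s l) (hm_b a l)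
      (fun j hj y ↦ hdcut_b l j (by omega) y))
    exact ⟨fun y ↦ by rw [← Real.norm_eq_abs]; exact h0 y, hw⟩
  have hθ3 : ∀ a l, (∀ y, |m a l y * ddcut a l y| ≤ Mθ) ∧ ∀ lst : List (Fin n), lst ≠ [] → lst.length ≤ k →
      ∀ y, ‖iterDirDeriv (lst.map e) (fun y ↦ m a l y * ddcut a l y) y‖ ≤ Mθ := by
    intro a l
    obtain ⟨h0, hw⟩ := norm_and_words_le_of_iteratedFDeriv_le ((hm_s a l).mul (hddcut_s a l)) (hprod (hm_s a l) (hddcut_s a l) (hm_b a l) (hddcut_b a l))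
    exact ⟨fun y ↦ by rw [← Real.norm_eq_abs]; exact h0 y, hw⟩
  have hθ4 : ∀ l, (∀ y, |dcut l y| ≤ Mθ) ∧ ∀ lst : List (Fin n), lst ≠ [] → lst.length ≤ k →
      ∀ y, ‖iterDirDeriv (lst.map e) (dcut l) y‖ ≤ Mθ := by
    intro l
    obtain ⟨h0, hw⟩ := norm_and_words_le_of_iteratedFDeriv_le (hdcut_s l) (k := k)
      (fun j hj y ↦ (hdcut_b l j (by omega) y).trans hMle)
    exact ⟨fun y ↦ by rw [← Real.norm_eq_abs]; exact h0 y, hw⟩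
  have hθ5 : ∀ l, (∀ y, ‖Bf l y‖ ≤ Mθ) ∧ ∀ lst : List (Fin n), lst ≠ [] → lst.length ≤ k →
      ∀ y, ‖iterDirDeriv (lst.map e) (Bf l) y‖ ≤ Mθ := fun l ↦
    norm_and_words_le_of_iteratedFDeriv_le (hBf_s l) (fun j hj y ↦ (hBf_b l j hj y).trans hMle)
  -- ## the four groups of terms
  obtain ⟨T1, hT1⟩ : ∃ T1 : E' → F', T1 = fun y ↦ ∑ a, ∑ l, (m a l y * dcut a y) • du l y := ⟨_, rfl⟩
  obtain ⟨T2, hT2⟩ : ∃ T2 : E' → F', T2 = fun y ↦ ∑ a, ∑ l, (m a l y * dcut l y) • du a y := ⟨_, rfl⟩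
  obtain ⟨T3, hT3⟩ : ∃ T3 : E' → F', T3 = fun y ↦ ∑ a, ∑ l, (m a l y * ddcut a l y) • u y := ⟨_, rfl⟩
  obtain ⟨T4, hT4⟩ : ∃ T4 : E' → F', T4 = fun y ↦ ∑ l, dcut l y • Bf l y (u y) := ⟨_, rfl⟩
  have hT1s : ContDiff ℝ ∞ T1 := by
    rw [hT1]; exact ContDiff.sum fun a _ ↦ ContDiff.sum fun l _ ↦ ((hm_s a l).mul (hdcut_s a)).smul (hdu_s l)
  have hT2s : ContDiff ℝ ∞ T2 := by
    rw [hT2]; exact ContDiff.sum fun a _ ↦ ContDiff.sum fun l _ ↦ ((hm_s a l).mul (hdcut_s l)).smul (hdu_s a)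
  have hT3s : ContDiff ℝ ∞ T3 := by
    rw [hT3]; exact ContDiff.sum fun a _ ↦ ContDiff.sum fun l _ ↦ ((hm_s a l).mul (hddcut_s a l)).smul hu
  have hT4s : ContDiff ℝ ∞ T4 := by
    rw [hT4]; exact ContDiff.sum fun l _ ↦ (hdcut_s l).smul ((hBf_s l).clm_apply hu)
  -- the identity `commOp = T1 + T2 + T3 + T4`
  have hid : (fun y ↦ commOp (S₀ y) (𝔟₀ y) (𝔠₀ y) cut u y) = fun y ↦ T1 y + T2 y + T3 y + T4 y := by
    funext y
    rw [commOp_eq (S₀ y) (𝔟₀ y) (𝔠₀ y) hcut hu y, lowerSymbol_apply, clm_smulRight_fderiv_eq_sum, hT1, hT2, hT3, hT4, hm,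
      hdcut, hddcut, hdu, hBf, hQ]
    simp only [ContinuousLinearMap.comp_apply, smul_add, mul_smul, Finset.sum_add_distrib, Finset.sum_smul]
    rfl
  -- ## energies of the groups
  have hE1 : sobolevEnergy k T1 ≤ (n : ℝ≥0∞) ^ 3 * A * ∑ l, sobolevEnergy k (du l) := by
    rw [hT1]
    have h1 : sobolevEnergy k (fun y ↦ ∑ a, ∑ l, (m a l y * dcut a y) • du l y) ≤ (n : ℝ≥0∞) * ∑ a, sobolevEnergy k (fun y ↦ ∑ l, (m a l y * dcut a y) • du l y) := by
      have h := sobolevEnergy_sum_le_card k Finset.univ (f := fun a y ↦ ∑ l, (m a l y * dcut a y) • du l y)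
        (fun a _ ↦ (ContDiff.sum fun l _ ↦ ((hm_s a l).mul (hdcut_s a)).smul (hdu_s l)).of_le (by exact_mod_cast le_top))
      rw [Finset.card_univ, Fintype.card_fin] at h
      exact h
    have h2 : ∀ a, sobolevEnergy k (fun y ↦ ∑ l, (m a l y * dcut a y) • du l y) ≤ (n : ℝ≥0∞) * ∑ l, A * sobolevEnergy k (du l) := by
      intro a
      have h := sobolevEnergy_sum_le_card k Finset.univ (f := fun l y ↦ (m a l y * dcut a y) • du l y)
        (fun l _ ↦ (((hm_s a l).mul (hdcut_s a)).smul (hdu_s l)).of_le (by exact_mod_cast le_top))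
      rw [Finset.card_univ, Fintype.card_fin] at h
      refine h.trans (mul_le_mul' le_rfl (Finset.sum_le_sum fun l _ ↦ ?_))
      exact hCcr ((hm_s a l).mul (hdcut_s a)) (hdu_s l) (hθ1 a l).1 (hθ1 a l).2
    calc sobolevEnergy k (fun y ↦ ∑ a, ∑ l, (m a l y * dcut a y) • du l y) ≤ (n : ℝ≥0∞) * ∑ a, sobolevEnergy k (fun y ↦ ∑ l, (m a l y * dcut a y) • du l y) := h1
      _ ≤ (n : ℝ≥0∞) * ∑ _a : Fin n, (n : ℝ≥0∞) * ∑ l, A * sobolevEnergy k (du l) :=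
          mul_le_mul' le_rfl (Finset.sum_le_sum fun a _ ↦ h2 a)
      _ = (n : ℝ≥0∞) ^ 3 * A * ∑ l, sobolevEnergy k (du l) := by
          rw [Finset.sum_const, Finset.card_univ, Fintype.card_fin, nsmul_eq_mul, ← Finset.mul_sum]; ring
  have hE2 : sobolevEnergy k T2 ≤ (n : ℝ≥0∞) ^ 3 * A * ∑ a, sobolevEnergy k (du a) := by
    rw [hT2]
    have h1 : sobolevEnergy k (fun y ↦ ∑ a, ∑ l, (m a l y * dcut l y) • du a y) ≤ (n : ℝ≥0∞) * ∑ a, sobolevEnergy k (fun y ↦ ∑ l, (m a l y * dcut l y) • du a y) := by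
      have h := sobolevEnergy_sum_le_card k Finset.univ (f := fun a y ↦ ∑ l, (m a l y * dcut l y) • du a y)
        (fun a _ ↦ (ContDiff.sum fun l _ ↦ ((hm_s a l).mul (hdcut_s l)).smul (hdu_s a)).of_le (by exact_mod_cast le_top))
      rw [Finset.card_univ, Fintype.card_fin] at h
      exact h
    have h2 : ∀ a, sobolevEnergy k (fun y ↦ ∑ l, (m a l y * dcut l y) • du a y) ≤ (n : ℝ≥0∞) * ∑ _l : Fin n, A * sobolevEnergy k (du a) := by
      intro a
      have h := sobolevEnergy_sum_le_card k Finset.univ (f := fun l y ↦ (m a l y * dcut l y) • du a y)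
        (fun l _ ↦ (((hm_s a l).mul (hdcut_s l)).smul (hdu_s a)).of_le (by exact_mod_cast le_top))
      rw [Finset.card_univ, Fintype.card_fin] at h
      refine h.trans (mul_le_mul' le_rfl (Finset.sum_le_sum fun l _ ↦ ?_))
      exact hCcr ((hm_s a l).mul (hdcut_s l)) (hdu_s a) (hθ2 a l).1 (hθ2 a l).2
    calc sobolevEnergy k (fun y ↦ ∑ a, ∑ l, (m a l y * dcut l y) • du a y) ≤ (n : ℝ≥0∞) * ∑ a, sobolevEnergy k (fun y ↦ ∑ l, (m a l y * dcut l y) • du a y) := h1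
      _ ≤ (n : ℝ≥0∞) * ∑ a, (n : ℝ≥0∞) * ∑ _l : Fin n, A * sobolevEnergy k (du a) :=
          mul_le_mul' le_rfl (Finset.sum_le_sum fun a _ ↦ h2 a)
      _ = (n : ℝ≥0∞) ^ 3 * A * ∑ a, sobolevEnergy k (du a) := by
          simp only [Finset.sum_const, Finset.card_univ, Fintype.card_fin, nsmul_eq_mul]
          rw [Finset.mul_sum, Finset.mul_sum]
          exact Finset.sum_congr rfl fun a _ ↦ by ring
  have hE3 : sobolevEnergy k T3 ≤ (n : ℝ≥0∞) ^ 4 * A * sobolevEnergy k u := by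
    rw [hT3]
    have h1 : sobolevEnergy k (fun y ↦ ∑ a, ∑ l, (m a l y * ddcut a l y) • u y) ≤ (n : ℝ≥0∞) * ∑ a, sobolevEnergy k (fun y ↦ ∑ l, (m a l y * ddcut a l y) • u y) := by
      have h := sobolevEnergy_sum_le_card k Finset.univ (f := fun a y ↦ ∑ l, (m a l y * ddcut a l y) • u y)
        (fun a _ ↦ (ContDiff.sum fun l _ ↦ ((hm_s a l).mul (hddcut_s a l)).smul hu).of_le (by exact_mod_cast le_top))
      rw [Finset.card_univ, Fintype.card_fin] at h
      exact h
    have h2 : ∀ a, sobolevEnergy k (fun y ↦ ∑ l, (m a l y * ddcut a l y) • u y) ≤ (n : ℝ≥0∞) * ∑ _l : Fin n, A * sobolevEnergy k u := by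
      intro a
      have h := sobolevEnergy_sum_le_card k Finset.univ (f := fun l y ↦ (m a l y * ddcut a l y) • u y)
        (fun l _ ↦ (((hm_s a l).mul (hddcut_s a l)).smul hu).of_le (by exact_mod_cast le_top))
      rw [Finset.card_univ, Fintype.card_fin] at h
      refine h.trans (mul_le_mul' le_rfl (Finset.sum_le_sum fun l _ ↦ ?_))
      exact hCcr ((hm_s a l).mul (hddcut_s a l)) hu (hθ3 a l).1 (hθ3 a l).2
    calc sobolevEnergy k (fun y ↦ ∑ a, ∑ l, (m a l y * ddcut a l y) • u y) ≤ (n : ℝ≥0∞) * ∑ a, sobolevEnergy k (fun y ↦ ∑ l, (m a l y * ddcut a l y) • u y) := h1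
      _ ≤ (n : ℝ≥0∞) * ∑ _a : Fin n, (n : ℝ≥0∞) * ∑ _l : Fin n, A * sobolevEnergy k u :=
          mul_le_mul' le_rfl (Finset.sum_le_sum fun a _ ↦ h2 a)
      _ = (n : ℝ≥0∞) ^ 4 * A * sobolevEnergy k u := by
          simp only [Finset.sum_const, Finset.card_univ, Fintype.card_fin, nsmul_eq_mul]; ring
  have hE4 : sobolevEnergy k T4 ≤ (n : ℝ≥0∞) ^ 2 * (A * B) * sobolevEnergy k u := by
    rw [hT4]
    have h1 : sobolevEnergy k (fun y ↦ ∑ l, dcut l y • Bf l y (u y)) ≤ (n : ℝ≥0∞) * ∑ l, sobolevEnergy k (fun y ↦ dcut l y • Bf l y (u y)) := by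
      have h := sobolevEnergy_sum_le_card k Finset.univ (f := fun l y ↦ dcut l y • Bf l y (u y))
        (fun l _ ↦ ((hdcut_s l).smul ((hBf_s l).clm_apply hu)).of_le (by exact_mod_cast le_top))
      rw [Finset.card_univ, Fintype.card_fin] at h
      exact h
    have h2 : ∀ l, sobolevEnergy k (fun y ↦ dcut l y • Bf l y (u y)) ≤ A * (B * sobolevEnergy k u) := by
      intro l
      refine (hCcr (hdcut_s l) ((hBf_s l).clm_apply hu) (hθ4 l).1 (hθ4 l).2).trans ?_
      exact mul_le_mul' le_rfl (hCcl (hBf_s l) hu (hθ5 l).1 (hθ5 l).2)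
    calc sobolevEnergy k (fun y ↦ ∑ l, dcut l y • Bf l y (u y)) ≤ (n : ℝ≥0∞) * ∑ l, sobolevEnergy k (fun y ↦ dcut l y • Bf l y (u y)) := h1
      _ ≤ (n : ℝ≥0∞) * ∑ _l : Fin n, A * (B * sobolevEnergy k u) := mul_le_mul' le_rfl (Finset.sum_le_sum fun l _ ↦ h2 l)
      _ = (n : ℝ≥0∞) ^ 2 * (A * B) * sobolevEnergy k u := by
          simp only [Finset.sum_const, Finset.card_univ, Fintype.card_fin, nsmul_eq_mul]; ring
  -- ## assemble
  have hk : ∀ {f : E' → F'}, ContDiff ℝ ∞ f → ContDiff ℝ k f := fun hf ↦ hf.of_le (by exact_mod_cast le_top)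
  rw [hid]
  calc sobolevEnergy k (fun y ↦ T1 y + T2 y + T3 y + T4 y)
      ≤ 2 * sobolevEnergy k (fun y ↦ T1 y + T2 y + T3 y) + 2 * sobolevEnergy k T4 :=
        sobolevEnergy_add_le k (hk ((hT1s.add hT2s).add hT3s)) (hk hT4s)
    _ ≤ 2 * (2 * sobolevEnergy k (fun y ↦ T1 y + T2 y) + 2 * sobolevEnergy k T3) + 2 * sobolevEnergy k T4 :=
        add_le_add (mul_le_mul' le_rfl (sobolevEnergy_add_le k (hk (hT1s.add hT2s)) (hk hT3s))) le_rfl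
    _ ≤ 2 * (2 * (2 * sobolevEnergy k T1 + 2 * sobolevEnergy k T2) + 2 * sobolevEnergy k T3) + 2 * sobolevEnergy k T4 :=
        add_le_add (mul_le_mul' le_rfl (add_le_add (mul_le_mul' le_rfl (sobolevEnergy_add_le k (hk hT1s) (hk hT2s))) le_rfl))
          le_rfl
    _ ≤ 2 * (2 * (2 * ((n : ℝ≥0∞) ^ 3 * A * ∑ l, sobolevEnergy k (du l)) + 2 * ((n : ℝ≥0∞) ^ 3 * A * ∑ a, sobolevEnergy k (du a))) +
          2 * ((n : ℝ≥0∞) ^ 4 * A * sobolevEnergy k u)) + 2 * ((n : ℝ≥0∞) ^ 2 * (A * B) * sobolevEnergy k u) := by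
        gcongr
    _ = 16 * (n : ℝ≥0∞) ^ 3 * A * (∑ a, sobolevEnergy k (du a)) +
          (4 * (n : ℝ≥0∞) ^ 4 * A + 2 * (n : ℝ≥0∞) ^ 2 * (A * B)) * sobolevEnergy k u := by ring
    _ ≤ (16 * (n : ℝ≥0∞) ^ 3 * A + 4 * (n : ℝ≥0∞) ^ 4 * A + 2 * (n : ℝ≥0∞) ^ 2 * (A * B)) *
          ((∑ a, sobolevEnergy k (du a)) + sobolevEnergy k u) := by
        rw [mul_add]
        refine add_le_add (mul_le_mul' (le_self_add.trans le_self_add) le_rfl) (mul_le_mul' ?_ le_rfl)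
        rw [add_assoc]
        exact le_add_self
    _ = _ := by rw [hdu]

end Energy

end Literature.Analysis.PDE
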